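import Literature.NumberTheory.EllipticCurves.Sprung2017.HalfLogarithmMatrixInvolutionLowerCyclotomicProofs
import Summits.BirchSwinnertonDyer.BirchSwinnertonDyer.Theorems.SignedLowerHalvesSprungLowerDivisibilityAtThreeIotaSharpOfFlat
import Summits.BirchSwinnertonDyer.Rank1Residual.Supersingular.SignedLambdaParity
import HarnessLib

/-!
# Crux `SprungLowerDivisibilityAtThree` (K1, item stmt-BirchSwinnertonDyer-19875), line `chromatic-common-zeros`:
# the ♯-ROW in final form — `κ′·L♯(T^ι) − m₀₀·L♯ = 3T·Φ₃(1+T)²·h·L♭`, `h ∈ Λˣ` — and the FULL SYMMETRY of the two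
# colours off the three primes `(3)`, `(T)`, `(Φ₃(1+T))` (X8, class-wide, input-free)

Cell `bsd-ssimc` (host), width seat `cruxlead-stmt-BirchSwinnertonDyer-19875-w3` (gen 5) under the 19875 lead; `--supports`
19875 `--as helper`; theorems only; closes NO item (skeleton v8 unchanged). K1, BSD and leaf X8 are NOT proved by anything
here. Sequel of `…IotaSharpOfFlat` (p642065) and `…IotaOrderSymmetric` (p645004), fed by the Literature companion
`HalfLogarithmMatrixInvolutionLowerCyclotomicProofs` (`M₁₀ = 3T·Φ₃(1+T)²·(unit)`: `v₁ = 0` and `Φ₃(1+T) ∣ v_n` for `n ≥ 2`).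

## What is proved

* **`ClassX8.exists_pair_functionalEquation_final`** — the pair functional equation with `κ′(0) = σ`, `M₀₁ = 3T·u` and
  `M₁₀ = 3T·Φ₃(1+T)²·h`, `u, h ∈ Λˣ`;
* **`ClassX8.flat_mem_of_sharp_mem_of_subst_sharp_mem`** — for every prime `𝔭 ⊂ Λ` with `3, T, Φ₃(1+T) ∉ 𝔭`:
  `L♯, L♯(T^ι) ∈ 𝔭 ⟹ L♭ ∈ 𝔭` (the ♯-analogue of p642065's `sharp_mem_of_flat_mem_of_subst_flat_mem`, now with an
  explicit exceptional prime instead of the zeros of an unnamed `g`);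
* **`ClassX8.sharp_iotaPair_iff_flat_iotaPair`** / **`ClassX8.mem_and_mem_iff_sharp_iotaPair`** — off `(3)`, `(T)`,
  `(Φ₃(1+T))`: `L♯, L♯(T^ι) ∈ 𝔭 ⟺ L♭, L♭(T^ι) ∈ 𝔭 ⟺ L♯, L♭ ∈ 𝔭` — the common-zero locus is the ι-paired zero set of
  EITHER colour; the asymmetry of the pair is concentrated at the level-1 cyclotomic prime `(Φ₃(1+T))`, where
  `Φ₃ ∣ L♭ ⟹ Φ₃ ∣ L♯` (p642657) but not conversely (x8 data, lit g47 T61: 14/217 cells with `L♯(ζ₃ − 1) = 0`, `Φ₃ ∤ L♭` —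
  [Sp17] Cor. 4.4: `u₁ = 1`, `v₁ = 0`, so the level-1 exceptional zero lives in `L♯`).

References: [Sprung2017] Thm. 4.13, Cor. 4.4, Cor. 4.6, Cor. 4.14, Prop. 3.14; [MazurTateTeitelbaum1986Invent] §I.17;
[GreenbergLNM1716] §1 and §5; [Sprung2012] Main Conj. 7.21 (context: stubs K_spor / S4b-cyc).
-/

set_option linter.dupNamespace false
set_option autoImplicit false

noncomputable section

open scoped Classical MatrixGroups ModularForm

open CongruenceSubgroup WeierstrassCurve Polynomial
  Literature.NumberTheory.EllipticCurves Literature.NumberTheory.EllipticCurves.ModularForms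
  Literature.NumberTheory.EllipticCurves.Sprung2017 Literature.NumberTheory.EllipticCurves.Rank1Residual
  Literature.Barriers.BirchSwinnertonDyer Summit.BirchSwinnertonDyer.Rank1Residual.Supersingular

namespace Summit.BirchSwinnertonDyer.BirchSwinnertonDyer.Theorems.ChromaticIota

/-! ## §1 X8: the pair functional equation in final form -/

section X8



/-- `ι ∘ ι = id` on `ℚ_3⟦T⟧` (private plumbing). [folklore] -/
private theorem subst_subst_rat₈ (g : PowerSeries ℚ_[3]) :
    PowerSeries.subst (invOnePlusSubOne : PowerSeries ℚ_[3])
      (PowerSeries.subst (invOnePlusSubOne : PowerSeries ℚ_[3]) g) = g := by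
  have hι := hasSubst_invOnePlusSubOne (R := ℚ_[3])
  rw [PowerSeries.subst_comp_subst_apply hι hι, invOnePlusSubOne_subst_self, PowerSeries.X_subst]

/-- `det ℒ(0) = 1/9 ≠ 0` (private plumbing). [cite: Sprung2017, §3.1 (ℒ(0) = C⁻²)] -/
private theorem det_halfLogMatrix_ne_zero₈ (b : ℤ) :
    halfLogMatrix b 0 0 * halfLogMatrix b 1 1 - halfLogMatrix b 0 1 * halfLogMatrix b 1 0 ≠ 0 := by
  intro h
  have h0 := congrArg PowerSeries.constantCoeff h
  rw [map_sub, map_mul, map_mul, constantCoeff_halfLogMatrix, constantCoeff_halfLogMatrix,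
    constantCoeff_halfLogMatrix, constantCoeff_halfLogMatrix, map_zero] at h0
  have hdetQ : (sprungCinv 3 (3 * b) ^ 2).det = 1 / 9 := by
    rw [Matrix.det_pow, Matrix.det_fin_two]
    simp [sprungCinv]
    norm_num
  have hcast : (((sprungCinv 3 (3 * b) ^ 2).det : ℚ) : ℚ_[3]) = 0 := by
    rw [Matrix.det_fin_two]
    push_cast
    linear_combination h0
  rw [hdetQ] at hcast
  norm_num at hcast

/-- **THE PAIR FUNCTIONAL EQUATION IN FINAL FORM.** For every X8 pair `(W, 3)`, newform `f` with `f|W_N = −σf` (`σ = ±1`),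
Sprung pair `(L♯, L♭)`: there are `κ′, u, h, m₀₀, m₁₁ ∈ Λ` with `κ′(0) = σ`, `u, h ∈ Λˣ`, `m₀₀(0) = m₁₁(0) = 1` and
`κ′·L♯(T^ι) = m₀₀·L♯ + C(3)·T·Φ₃(1+T)²·h·L♭`, `κ′·L♭(T^ι) = C(3)·T·u·L♯ + m₁₁·L♭` (`Φ₃(1+T) = (1+T)² + (1+T) + 1`).
[cite: Sprung2017, Thm. 1.1, Thm. 4.13, Cor. 4.14, Prop. 3.14, Cor. 4.4 and Cor. 4.6] [cite: MazurTateTeitelbaum1986Invent, §I.17]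
[cite: GreenbergLNM1716, §1] -/
theorem ClassX8.exists_pair_functionalEquation_final (W : WeierstrassCurve ℚ) [W.IsElliptic] [W.IsGloballyMinimal]
    (p : ℕ) [Fact p.Prime] (hX : ClassX8 W p) {N : ℕ} [hN : NeZero N] (f : CuspForm (Gamma0 N) 2)
    (hf : IsNewformOf W f) {σ : ℤ} (hσ : σ = 1 ∨ σ = -1) (hW : IsFrickeEigen N f (-(σ : ℂ)))
    (Lsharp Lflat : IwasawaAlgebra p) (hSP : IsSprungPair f p (W.frobeniusTrace p) Lsharp Lflat) :
    ∃ κ' u h m₀₀ m₁₁ : IwasawaAlgebra p, PowerSeries.constantCoeff κ' = σ ∧ IsUnit u ∧ IsUnit h ∧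
      PowerSeries.constantCoeff m₀₀ = 1 ∧ PowerSeries.constantCoeff m₁₁ = 1 ∧
      κ' * PowerSeries.subst (invOnePlusSubOne : IwasawaAlgebra p) Lsharp =
        m₀₀ * Lsharp + PowerSeries.C (p : ℤ_[p]) * PowerSeries.X *
          (((1 + PowerSeries.X : IwasawaAlgebra p) ^ 2 + (1 + PowerSeries.X) + 1) ^ 2) * h * Lflat ∧
      κ' * PowerSeries.subst (invOnePlusSubOne : IwasawaAlgebra p) Lflat =
        PowerSeries.C (p : ℤ_[p]) * PowerSeries.X * u * Lsharp + m₁₁ * Lflat := by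
  obtain ⟨hp3, ⟨hgood, -⟩, -⟩ := id hX
  subst hp3
  haveI : NeZero N := hN
  have hσ2 : σ ^ 2 = 1 := by rcases hσ with rfl | rfl <;> norm_num
  -- `a_3 = 3b`, `b = ±1`, so `3 ∤ b`
  obtain ⟨b, hb, hab⟩ : ∃ b : ℤ, (b = 1 ∨ b = -1) ∧ W.frobeniusTrace 3 = 3 * b := by
    rcases ClassX8.frobeniusTrace_eq_three_or W 3 hX with h | h
    · exact ⟨1, Or.inl rfl, by rw [h]; norm_num⟩
    · exact ⟨-1, Or.inr rfl, by rw [h]; norm_num⟩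
  have hb3 : ¬ (3 : ℤ) ∣ b := by rcases hb with rfl | rfl <;> decide
  rw [hab] at hSP
  -- the Teichmüller exponent of the level (`3 ∤ N`)
  have hpN : ¬ 3 ∣ N := not_dvd_level_of_isNewformOf hf hgood
  obtain ⟨ηN, c, hc⟩ := exists_teichmuller_exponent_natCast (p := 3) hpN
  -- the functional equation of the trace coordinates (PROVED fact) and the refined integral transition matrix
  have hFE := thm413_traceCoordinate_functionalEquation_three_holds W N f b hb hf hgood hab σ hσ2 hW ηN c hc
    invOnePlusSubOne one_add_X_mul_invOnePlusSubOne_add_one Lsharp Lflat hSP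
  obtain ⟨M, ⟨u, hu, hM01⟩, ⟨h, hh, hM10⟩, hM00, hM11, hM⟩ :=
    exists_integral_halfLogMatrix_offDiag_final b hb3
  -- cancelling `ℒ` in `ℚ_3⟦T⟧`
  have hι := hasSubst_invOnePlusSubOne (R := ℚ_[3])
  set τ : PowerSeries ℚ_[3] →+* PowerSeries ℚ_[3] := (PowerSeries.substAlgHom hι).toRingHom with hτ
  have hτapp : ∀ x : PowerSeries ℚ_[3], τ x = PowerSeries.subst (invOnePlusSubOne : PowerSeries ℚ_[3]) x :=
    fun x => by rw [hτ, AlgHom.toRingHom_eq_coe, RingHom.coe_coe, PowerSeries.coe_substAlgHom]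
  have hττ : ∀ x, τ (τ x) = x := fun x => by rw [hτapp, hτapp, subst_subst_rat₈]
  set κ : PowerSeries ℚ_[3] :=
    (σ : PowerSeries ℚ_[3]) * (PowerSeries.binomialSeries ℤ_[3] c).map (algebraMap ℤ_[3] ℚ_[3]) with hκ
  set L : Fin 2 → PowerSeries ℚ_[3] := ![iwasawaToPowerSeries 3 Lsharp, iwasawaToPowerSeries 3 Lflat] with hL
  have hL0 : L 0 = iwasawaToPowerSeries 3 Lsharp := rfl
  have hL1 : L 1 = iwasawaToPowerSeries 3 Lflat := rfl
  have hFE' : ∀ k : Fin 2, τ (L 0 * halfLogMatrix b 0 k + L 1 * halfLogMatrix b 1 k) =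
      κ * (L 0 * halfLogMatrix b 0 k + L 1 * halfLogMatrix b 1 k) := by
    intro k
    rw [hτapp, hL0, hL1]
    exact hFE k
  have hM' : ∀ i k : Fin 2, halfLogMatrix b i k =
      (M.map (iwasawaToPowerSeries 3)) i 0 * τ (halfLogMatrix b 0 k) +
        (M.map (iwasawaToPowerSeries 3)) i 1 * τ (halfLogMatrix b 1 k) := by
    intro i k
    rw [Matrix.map_apply, Matrix.map_apply, hτapp, hτapp]
    exact hM i k
  have key := mul_map_eq_of_traceFE τ hττ L (halfLogMatrix b) (M.map (iwasawaToPowerSeries 3)) κ hFE' hM'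
    (det_halfLogMatrix_ne_zero₈ b)
  -- pull back to `Λ`
  set κΛ : IwasawaAlgebra 3 := (σ : IwasawaAlgebra 3) * PowerSeries.binomialSeries ℤ_[3] c with hκΛ
  have hκι : κ = iwasawaToPowerSeries 3 κΛ := by rw [hκ, hκΛ, map_mul, map_intCast]
  have hκ0 : PowerSeries.constantCoeff (PowerSeries.subst (invOnePlusSubOne : IwasawaAlgebra 3) κΛ) = σ := by
    rw [Literature.Barriers.BirchSwinnertonDyer.constantCoeff_subst_of_constantCoeff_eq_zero
      constantCoeff_invOnePlusSubOne, hκΛ, map_mul, map_intCast,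
      PowerSeries.binomialSeries_constantCoeff, mul_one]
  have hpull : ∀ (Ll : IwasawaAlgebra 3) (m0 m1 : IwasawaAlgebra 3),
      τ κ * τ (iwasawaToPowerSeries 3 Ll) = iwasawaToPowerSeries 3 Lsharp * iwasawaToPowerSeries 3 m0 +
        iwasawaToPowerSeries 3 Lflat * iwasawaToPowerSeries 3 m1 →
      PowerSeries.subst (invOnePlusSubOne : IwasawaAlgebra 3) κΛ *
          PowerSeries.subst (invOnePlusSubOne : IwasawaAlgebra 3) Ll = Lsharp * m0 + Lflat * m1 := by
    intro Ll m0 m1 h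
    apply iwasawaToPowerSeries_injective 3
    rw [map_mul, map_add, map_mul, map_mul, iwasawaToPowerSeries_subst_invOnePlusSubOne,
      iwasawaToPowerSeries_subst_invOnePlusSubOne, ← hκι, ← hτapp, ← hτapp]
    exact h
  have hs : PowerSeries.subst (invOnePlusSubOne : IwasawaAlgebra 3) κΛ *
      PowerSeries.subst (invOnePlusSubOne : IwasawaAlgebra 3) Lsharp = Lsharp * M 0 0 + Lflat * M 1 0 := by
    apply hpull
    have h0 := key 0
    rw [hL0, hL1, Matrix.map_apply, Matrix.map_apply] at h0
    simpa using h0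
  have hfl : PowerSeries.subst (invOnePlusSubOne : IwasawaAlgebra 3) κΛ *
      PowerSeries.subst (invOnePlusSubOne : IwasawaAlgebra 3) Lflat = Lsharp * M 0 1 + Lflat * M 1 1 := by
    apply hpull
    have h1 := key 1
    rw [hL0, hL1, Matrix.map_apply, Matrix.map_apply] at h1
    simpa using h1
  refine ⟨PowerSeries.subst (invOnePlusSubOne : IwasawaAlgebra 3) κΛ, u, h, M 0 0, M 1 1, hκ0, hu, hh, hM00, hM11,
    ?_, ?_⟩
  · rw [hs, hM10]
    push_cast
    ring
  · rw [hfl, hM01]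
    push_cast
    ring



/-! ## §2 X8: the ♯-row one-colour criterion and the full symmetry off `(3)`, `(T)`, `(Φ₃(1+T))` -/

/-- **ι-PAIRED ZEROS OF `L♯` ARE COMMON ZEROS, off `(3)`, `(T)`, `(Φ₃(1+T))`.** For every X8 pair, newform, Sprung pair and
every prime `𝔭 ⊂ Λ` with `3 ∉ 𝔭`, `T ∉ 𝔭`, `Φ₃(1+T) = (1+T)² + (1+T) + 1 ∉ 𝔭`: `L♯ ∈ 𝔭` and `L♯(T^ι) ∈ 𝔭` imply `L♭ ∈ 𝔭`.
[cite: Sprung2017, Thm. 4.13, Cor. 4.14, Prop. 3.14 and Cor. 4.6] [cite: GreenbergLNM1716, §1 and §5] -/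
theorem ClassX8.flat_mem_of_sharp_mem_of_subst_sharp_mem (W : WeierstrassCurve ℚ) [W.IsElliptic]
    [W.IsGloballyMinimal] (p : ℕ) [Fact p.Prime] (hX : ClassX8 W p) {N : ℕ} [hN : NeZero N]
    (f : CuspForm (Gamma0 N) 2) (hf : IsNewformOf W f) (Lsharp Lflat : IwasawaAlgebra p)
    (hSP : IsSprungPair f p (W.frobeniusTrace p) Lsharp Lflat) (𝔭 : Ideal (IwasawaAlgebra p)) (h𝔭 : 𝔭.IsPrime)
    (hp𝔭 : (p : IwasawaAlgebra p) ∉ 𝔭) (hT : (PowerSeries.X : IwasawaAlgebra p) ∉ 𝔭)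
    (hΦ : ((1 + PowerSeries.X : IwasawaAlgebra p) ^ 2 + (1 + PowerSeries.X) + 1) ∉ 𝔭) (hsh : Lsharp ∈ 𝔭)
    (hshι : PowerSeries.subst (invOnePlusSubOne : IwasawaAlgebra p) Lsharp ∈ 𝔭) : Lflat ∈ 𝔭 := by
  haveI : NeZero N := hN
  obtain ⟨σ, hσ, -, hW⟩ := exists_sign_isFrickeEigen hf
  obtain ⟨κ', u, h, m₀₀, m₁₁, -, -, hh, -, -, hs, -⟩ :=
    ClassX8.exists_pair_functionalEquation_final W p hX f hf hσ hW Lsharp Lflat hSP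
  have hmem : PowerSeries.C (p : ℤ_[p]) * PowerSeries.X *
      (((1 + PowerSeries.X : IwasawaAlgebra p) ^ 2 + (1 + PowerSeries.X) + 1) ^ 2) * h * Lflat ∈ 𝔭 := by
    have heq : PowerSeries.C (p : ℤ_[p]) * PowerSeries.X *
        (((1 + PowerSeries.X : IwasawaAlgebra p) ^ 2 + (1 + PowerSeries.X) + 1) ^ 2) * h * Lflat =
        κ' * PowerSeries.subst (invOnePlusSubOne : IwasawaAlgebra p) Lsharp - m₀₀ * Lsharp := by
      rw [hs]
      ring
    rw [heq]
    exact 𝔭.sub_mem (𝔭.mul_mem_left _ hshι) (𝔭.mul_mem_left _ hsh)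
  rcases h𝔭.mem_or_mem hmem with h1 | hF
  · rcases h𝔭.mem_or_mem h1 with h2 | hh'
    · rcases h𝔭.mem_or_mem h2 with h3 | hΦ2
      · rcases h𝔭.mem_or_mem h3 with hC | hX'
        · rw [map_natCast] at hC
          exact absurd hC hp𝔭
        · exact absurd hX' hT
      · rw [pow_two] at hΦ2
        rcases h𝔭.mem_or_mem hΦ2 with hΦ' | hΦ'
        · exact absurd hΦ' hΦ
        · exact absurd hΦ' hΦ
    · exact absurd (Ideal.eq_top_of_isUnit_mem _ hh' hh) h𝔭.ne_top
  · exact hF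

/-- **COMMON ZEROS = ι-PAIRED ZEROS OF `L♯`, off `(3)`, `(T)`, `(Φ₃(1+T))`.** For a prime `𝔭` avoiding the three primes:
`(L♯ ∈ 𝔭 ∧ L♭ ∈ 𝔭) ⟺ (L♯ ∈ 𝔭 ∧ L♯(T^ι) ∈ 𝔭)`. [cite: Sprung2017, Thm. 4.13 and Cor. 4.14] [cite: GreenbergLNM1716, §1 and §5]
[cite: Sprung2012, Main Conj. 7.21 (context)] -/
theorem ClassX8.mem_and_mem_iff_sharp_iotaPair (W : WeierstrassCurve ℚ) [W.IsElliptic] [W.IsGloballyMinimal]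
    (p : ℕ) [Fact p.Prime] (hX : ClassX8 W p) {N : ℕ} [hN : NeZero N] (f : CuspForm (Gamma0 N) 2)
    (hf : IsNewformOf W f) (Lsharp Lflat : IwasawaAlgebra p)
    (hSP : IsSprungPair f p (W.frobeniusTrace p) Lsharp Lflat) (𝔭 : Ideal (IwasawaAlgebra p)) (h𝔭 : 𝔭.IsPrime)
    (hp𝔭 : (p : IwasawaAlgebra p) ∉ 𝔭) (hT : (PowerSeries.X : IwasawaAlgebra p) ∉ 𝔭)
    (hΦ : ((1 + PowerSeries.X : IwasawaAlgebra p) ^ 2 + (1 + PowerSeries.X) + 1) ∉ 𝔭) :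
    (Lsharp ∈ 𝔭 ∧ Lflat ∈ 𝔭) ↔
      (Lsharp ∈ 𝔭 ∧ PowerSeries.subst (invOnePlusSubOne : IwasawaAlgebra p) Lsharp ∈ 𝔭) := by
  constructor
  · rintro ⟨hs, hfl⟩
    exact ⟨hs, (ClassX8.subst_invOnePlusSubOne_mem_of_mem W p hX N hN f Lsharp Lflat hf hSP 𝔭 hs hfl).1⟩
  · rintro ⟨hs, hsι⟩
    exact ⟨hs, ClassX8.flat_mem_of_sharp_mem_of_subst_sharp_mem W p hX f hf Lsharp Lflat hSP 𝔭 h𝔭 hp𝔭 hT hΦ hs hsι⟩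

/-- **FULL SYMMETRY OF THE TWO COLOURS off `(3)`, `(T)`, `(Φ₃(1+T))`**: for a prime `𝔭` avoiding the three primes,
`(L♯ ∈ 𝔭 ∧ L♯(T^ι) ∈ 𝔭) ⟺ (L♭ ∈ 𝔭 ∧ L♭(T^ι) ∈ 𝔭)` — the ι-paired zero sets of the two colours coincide there (both equal
the common-zero locus). The asymmetry of the non-completed pair sits at the level-1 cyclotomic prime only.
[cite: Sprung2017, Thm. 4.13, Cor. 4.4 and Cor. 4.14] [cite: GreenbergLNM1716, §1 and §5] -/
theorem ClassX8.sharp_iotaPair_iff_flat_iotaPair (W : WeierstrassCurve ℚ) [W.IsElliptic] [W.IsGloballyMinimal]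
    (p : ℕ) [Fact p.Prime] (hX : ClassX8 W p) {N : ℕ} [hN : NeZero N] (f : CuspForm (Gamma0 N) 2)
    (hf : IsNewformOf W f) (Lsharp Lflat : IwasawaAlgebra p)
    (hSP : IsSprungPair f p (W.frobeniusTrace p) Lsharp Lflat) (𝔭 : Ideal (IwasawaAlgebra p)) (h𝔭 : 𝔭.IsPrime)
    (hp𝔭 : (p : IwasawaAlgebra p) ∉ 𝔭) (hT : (PowerSeries.X : IwasawaAlgebra p) ∉ 𝔭)
    (hΦ : ((1 + PowerSeries.X : IwasawaAlgebra p) ^ 2 + (1 + PowerSeries.X) + 1) ∉ 𝔭) :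
    (Lsharp ∈ 𝔭 ∧ PowerSeries.subst (invOnePlusSubOne : IwasawaAlgebra p) Lsharp ∈ 𝔭) ↔
      (Lflat ∈ 𝔭 ∧ PowerSeries.subst (invOnePlusSubOne : IwasawaAlgebra p) Lflat ∈ 𝔭) := by
  rw [← ClassX8.mem_and_mem_iff_sharp_iotaPair W p hX f hf Lsharp Lflat hSP 𝔭 h𝔭 hp𝔭 hT hΦ,
    ClassX8.mem_and_mem_iff_flat_iotaPair W p hX f hf Lsharp Lflat hSP 𝔭 h𝔭 hp𝔭 hT]

end X8

end Summit.BirchSwinnertonDyer.BirchSwinnertonDyer.Theorems.ChromaticIota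

end
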